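import Literature.Algebra.Polynomial.PowerSeriesInDeltaOperator
import Mathlib.Tactic
import HarnessLib

/-!
# Basic sequences from their linear coefficients: Theorem 5 and its Corollary 1 (Rota–Kahaner–Odlyzko §4)

G.-C. Rota, D. Kahaner, A. Odlyzko, *Finite operator calculus* (1973), §4, pp. 696–697:

> A last (and useful) characterization of basic sets is the following theorem.
> **Theorem 5.** Let `P` be an invertible shift-invariant operator. Let `p_n (x)` be a sequence of
> basic polynomials satisfying `[x⁻¹ p_n (x)]_{x=0} = n [P⁻¹ p_{n−1} (x)]_{x=0}` for all `n > 0`. Then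
> `p_n (x)` is the sequence of basic polynomials for the delta operator `Q = DP`.
> *Proof.* Define the operator `Q` by setting `Q1 = 0`, `Q p_n (x) = n p_{n−1} (x)` and extending by
> linearity. It is easily seen that `Q` is shift-invariant. In terms of `Q`, the preceding identity can
> be rewritten in the form `[x⁻¹ p (x)]_{x=0} = [P⁻¹ Q p (x)]_{x=0}` … for all polynomials `p (x)` with
> `p (0) = 0` … Thus `[D p (x)]_{x=0} = [P⁻¹ Q p (x)]_{x=0}` for all polynomials … But this means that
> `D = P⁻¹ Q`, or `Q = DP`. Q.E.D.
> **Corollary 1.** Given any sequence of constants `c_{n,1}`, `n = 1, 2, …`, with `c_{1,1} ≠ 0` there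
> exists a unique sequence of basic polynomials `p_n (x)` such that `[x⁻¹ p_n (x)]_{x=0} = c_{n,1}`,
> that is, `p_n (x) = Σ_{k≥1} c_{n,k} xᵏ`, `n = 1, 2, …`.
> **Corollary 2.** Let `q (t)` be the indicator of `Q` in the preceding corollary. Then `q = f⁻¹`, where
> `f (t) = Σ_{k≥1} c_{k,1} tᵏ/k!`.

Reading: "a sequence of basic polynomials" = a basic sequence of SOME delta operator (equivalently a
sequence of binomial type — the shift-invariance of the `Q` of the proof is Theorem 1); for such
`p_n` (`p_n (0) = 0`, `n ≥ 1`) the symbol `[x⁻¹ p_n (x)]_{x=0}` is the coefficient of `x`, `[x] p_n =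
(p_n).coeff 1 = (D p_n)(0)`; `P = π(D)` with `π (0) ≠ 0`, `P⁻¹ = π⁻¹(D)` (`diffOp`).

Typed here (all proved): Theorem 5 as the operator identity `Q = D P` (`eq_derivative_comp_diffOp_of_coeff_one`)
and as printed (`isBasicSequence_derivative_comp_diffOp_of_coeff_one`), with its (easy, unprinted)
converse `coeff_one_eq_of_isBasicSequence_derivative_comp_diffOp`; Corollary 1 — existence
(`exists_isBasicSequence_coeff_one_eq`, with the explicit operator `Q = f⁻¹(D)`,
`coeff_one_basicSequence_indicator`) and uniqueness (`IsBasicSequence.eq_of_coeff_one_eq`: two basic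
sequences with the same linear coefficients coincide, and so do their delta operators), packaged as
`existsUnique_isBasicSequence_coeff_one_eq`. Corollary 2 is already the tree's
`IsDeltaOperator.indicator_derivative_eq_mk` / `indicator_derivative_eq_substInv` (`PowerSeriesInDeltaOperator`),
on which the proofs here rest.

## References
* [RotaKahanerOdlyzko1973] G.-C. Rota, D. Kahaner, A. Odlyzko, *On the foundations of
  combinatorial theory VIII. Finite operator calculus*, J. Math. Anal. Appl. 42 (1973) 684–760,
  §4 Theorem 5 and Corollaries 1–2, pp. 696–697.
-/

noncomputable section

open Polynomial Finset

namespace Literature.Algebra.Polynomial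

variable {K : Type*} [Field K] [CharZero K]

/-! ## Theorem 5: `[x] p_n = n [P⁻¹ p_{n−1}]_{x=0}` forces `Q = DP` -/

/-- **Theorem 5, the operator identity `Q = DP`**: if the basic sequence `(p_n)` of a delta operator
`Q` satisfies `[x] p_n = n [P⁻¹ p_{n−1}]_{x=0}` (`n ≥ 1`) for an invertible `P = π(D)`, then
`Q = D P` ("`[D p]_{x=0} = [P⁻¹ Q p]_{x=0}` for all polynomials … this means `D = P⁻¹ Q`").
[cite: RotaKahanerOdlyzko1973, §4 Theorem 5, pp. 696–697] -/
theorem eq_derivative_comp_diffOp_of_coeff_one {π : PowerSeries K} (hπ : PowerSeries.constantCoeff π ≠ 0)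
    {Q : K[X] →ₗ[K] K[X]} {p : ℕ → K[X]} (hQ : IsDeltaOperator Q) (hp : IsBasicSequence Q p)
    (h : ∀ n : ℕ, (p (n + 1)).coeff 1 = ((n + 1 : ℕ) : K) * (diffOp π⁻¹ (p n)).eval 0) :
    Q = derivative ∘ₗ diffOp π := by
  -- `D = P⁻¹ Q`: both are composition operators, and their `Q`-indicators agree term by term
  have hD : (derivative : K[X] →ₗ[K] K[X]) = diffOp π⁻¹ ∘ₗ Q := by
    refine isShiftInvariant_derivative.indicator_injective
      ((isShiftInvariant_diffOp _).comp hQ.isShiftInvariant) hQ ?_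
    rw [hQ.indicator_eq_mk hp, hQ.indicator_eq_mk hp]
    ext k
    rw [PowerSeries.coeff_mk, PowerSeries.coeff_mk, eval_zero_derivative_eq_coeff_one, LinearMap.comp_apply]
    cases k with
    | zero => rw [hp.apply_zero, hQ.map_one, map_zero, eval_zero, ← C_1, coeff_C, if_neg one_ne_zero]
    | succ n => rw [hp.map_succ, map_smul, eval_smul, smul_eq_mul, h n]
  -- hence `P D = P P⁻¹ Q = Q`, and `P D = D P`
  calc Q = (diffOp π ∘ₗ diffOp π⁻¹) ∘ₗ Q := by rw [diffOp_comp_diffOp_inv hπ, LinearMap.id_comp]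
    _ = diffOp π ∘ₗ derivative := by rw [LinearMap.comp_assoc, ← hD]
    _ = derivative ∘ₗ diffOp π := by rw [← diffOp_X, ← diffOp_mul, ← diffOp_mul, mul_comm]

/-- **Theorem 5** as printed: under the hypothesis of `eq_derivative_comp_diffOp_of_coeff_one`, "`p_n (x)`
is the sequence of basic polynomials for the delta operator `Q = DP`".
[cite: RotaKahanerOdlyzko1973, §4 Theorem 5, pp. 696–697] -/
theorem isBasicSequence_derivative_comp_diffOp_of_coeff_one {π : PowerSeries K}
    (hπ : PowerSeries.constantCoeff π ≠ 0) {Q : K[X] →ₗ[K] K[X]} {p : ℕ → K[X]} (hQ : IsDeltaOperator Q)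
    (hp : IsBasicSequence Q p)
    (h : ∀ n : ℕ, (p (n + 1)).coeff 1 = ((n + 1 : ℕ) : K) * (diffOp π⁻¹ (p n)).eval 0) :
    IsBasicSequence (derivative ∘ₗ diffOp π) p := by
  rwa [← eq_derivative_comp_diffOp_of_coeff_one hπ hQ hp h]

/-- The converse of Theorem 5 (immediate, recorded for completeness): the basic sequence of `Q = DP`
satisfies `[x] p_n = [D p_n]_{x=0} = [P⁻¹ Q p_n]_{x=0} = n [P⁻¹ p_{n−1}]_{x=0}`.
[cite: RotaKahanerOdlyzko1973, §4 Theorem 5 (proof), p. 697] -/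
theorem coeff_one_eq_of_isBasicSequence_derivative_comp_diffOp {π : PowerSeries K}
    (hπ : PowerSeries.constantCoeff π ≠ 0) {p : ℕ → K[X]} (hp : IsBasicSequence (derivative ∘ₗ diffOp π) p)
    (n : ℕ) : (p (n + 1)).coeff 1 = ((n + 1 : ℕ) : K) * (diffOp π⁻¹ (p n)).eval 0 := by
  have hD : (derivative : K[X] →ₗ[K] K[X]) = diffOp π⁻¹ ∘ₗ (derivative ∘ₗ diffOp π) := by
    rw [← diffOp_X, ← diffOp_mul, ← diffOp_mul, mul_left_comm, PowerSeries.inv_mul_cancel π hπ, mul_one]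
  rw [← eval_zero_derivative_eq_coeff_one, hD, LinearMap.comp_apply, hp.map_succ, map_smul, eval_smul,
    smul_eq_mul]

/-! ## Corollary 1: a basic sequence is determined by, and exists for, any linear coefficients `c_{n,1}`, `c_{1,1} ≠ 0` -/

/-- **Corollary 1, uniqueness**: two basic sequences (of delta operators `Q`, `Q'`) with the same
linear coefficients `[x] p_n = [x] p'_n` have the same delta operator …
[cite: RotaKahanerOdlyzko1973, §4 Theorem 5 Corollary 1, p. 697] -/
theorem IsDeltaOperator.eq_of_coeff_one_eq {Q Q' : K[X] →ₗ[K] K[X]} {p p' : ℕ → K[X]}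
    (hQ : IsDeltaOperator Q) (hp : IsBasicSequence Q p) (hQ' : IsDeltaOperator Q') (hp' : IsBasicSequence Q' p')
    (h : ∀ n, (p n).coeff 1 = (p' n).coeff 1) : Q = Q' := by
  obtain ⟨q, hq⟩ := isShiftInvariant_iff_exists_eq_diffOp.1 hQ.isShiftInvariant
  obtain ⟨q', hq'⟩ := isShiftInvariant_iff_exists_eq_diffOp.1 hQ'.isShiftInvariant
  -- the `Q`- and `Q'`-indicators of `D` (the compositional inverses of `q`, `q'`) coincide
  have hind : hQ.indicator derivative = hQ'.indicator derivative := by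
    rw [hQ.indicator_derivative_eq_mk hp, hQ'.indicator_derivative_eq_mk hp']
    simp only [h]
  -- so `q` and `q'` are both right inverses of the same delta series, hence equal
  have hF : IsDeltaOperator (diffOp (hQ.indicator derivative)) :=
    (isDeltaOperator_diffOp_iff _).2 ⟨hQ.constantCoeff_indicator_derivative, fun h0 => by
      have h1 := hQ.coeff_one_indicator_derivative_mul hq
      rw [h0, zero_mul] at h1
      exact zero_ne_one h1⟩
  have hqq' : q = q' := by
    refine subst_injective_of_isDeltaOperator hF ?_
    rw [hQ.subst_indicator_derivative hq, hind, hQ'.subst_indicator_derivative hq']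
  rw [hq, hq', hqq']

/-- … and therefore coincide ("there exists a unique sequence of basic polynomials `p_n (x)` such that
`[x⁻¹ p_n (x)]_{x=0} = c_{n,1}`", uniqueness half). [cite: RotaKahanerOdlyzko1973, §4 Theorem 5
Corollary 1, p. 697] -/
theorem IsBasicSequence.eq_of_coeff_one_eq {Q Q' : K[X] →ₗ[K] K[X]} {p p' : ℕ → K[X]}
    (hQ : IsDeltaOperator Q) (hp : IsBasicSequence Q p) (hQ' : IsDeltaOperator Q') (hp' : IsBasicSequence Q' p')
    (h : ∀ n, (p n).coeff 1 = (p' n).coeff 1) : p = p' := by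
  have hQQ' := hQ.eq_of_coeff_one_eq hp hQ' hp' h
  subst hQQ'
  exact hp.unique hQ hp'

omit [CharZero K] in
/-- The series `f (t) = Σ_{k≥1} c_{k,1} tᵏ/k!` of Corollary 2 is a delta series when `c_{0} = 0`,
`c_{1,1} ≠ 0`. [cite: RotaKahanerOdlyzko1973, §4 Theorem 5 Corollaries 1–2, p. 697] -/
theorem isDeltaOperator_diffOp_mk_div_factorial {c : ℕ → K} (hc0 : c 0 = 0) (hc1 : c 1 ≠ 0) :
    IsDeltaOperator (diffOp (PowerSeries.mk fun k => c k / (k.factorial : K))) := by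
  refine (isDeltaOperator_diffOp_iff _).2 ⟨?_, ?_⟩
  · rw [← PowerSeries.coeff_zero_eq_constantCoeff_apply, PowerSeries.coeff_mk, hc0, zero_div]
  · rw [PowerSeries.coeff_mk, Nat.factorial_one, Nat.cast_one, div_one]
    exact hc1

/-- **Corollary 1, existence, with the operator made explicit**: for `f (t) = Σ_k c_k tᵏ/k!`
(`c_0 = 0`, `c_1 ≠ 0`) and `q = f⁻¹` its compositional inverse (the `f(D)`-indicator of `D`), the
basic sequence of `Q = q(D)` has linear coefficients `[x] p_n = c_n`.
[cite: RotaKahanerOdlyzko1973, §4 Theorem 5 Corollaries 1–2, p. 697] -/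
theorem coeff_one_basicSequence_indicator {c : ℕ → K} (hc0 : c 0 = 0) (hc1 : c 1 ≠ 0)
    (hQ : IsDeltaOperator (diffOp ((isDeltaOperator_diffOp_mk_div_factorial hc0 hc1).indicator derivative)))
    (n : ℕ) : (hQ.basicSequence n).coeff 1 = c n := by
  set hF := isDeltaOperator_diffOp_mk_div_factorial hc0 hc1
  -- the `Q`-indicator of `D` is the inverse of `q = f⁻¹`, i.e. `f` itself
  have hinv : hQ.indicator derivative = PowerSeries.mk fun k => c k / (k.factorial : K) := by
    refine subst_injective_of_isDeltaOperator hQ ?_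
    rw [hQ.indicator_derivative_subst rfl, hF.subst_indicator_derivative rfl]
  have hk := congrArg (PowerSeries.coeff n) hinv
  rw [hQ.coeff_indicator_derivative, PowerSeries.coeff_mk] at hk
  have hn : (n.factorial : K) ≠ 0 := Nat.cast_ne_zero.2 (Nat.factorial_ne_zero n)
  exact (div_left_inj' hn).1 hk

/-- The operator of `coeff_one_basicSequence_indicator` IS a delta operator (so the statement is not
vacuous). [cite: RotaKahanerOdlyzko1973, §4 Theorem 5 Corollaries 1–2, p. 697] -/
theorem isDeltaOperator_diffOp_indicator_mk_div_factorial {c : ℕ → K} (hc0 : c 0 = 0) (hc1 : c 1 ≠ 0) :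
    IsDeltaOperator (diffOp ((isDeltaOperator_diffOp_mk_div_factorial hc0 hc1).indicator derivative)) := by
  set hF := isDeltaOperator_diffOp_mk_div_factorial hc0 hc1
  refine (isDeltaOperator_diffOp_iff _).2 ⟨hF.constantCoeff_indicator_derivative, fun h0 => ?_⟩
  have h1 := hF.coeff_one_indicator_derivative_mul rfl
  rw [h0, zero_mul] at h1
  exact zero_ne_one h1

/-- **Corollary 1, existence**: "Given any sequence of constants `c_{n,1}`, `n = 1, 2, …`, with
`c_{1,1} ≠ 0` there exists a … sequence of basic polynomials `p_n (x)` such that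
`[x⁻¹ p_n (x)]_{x=0} = c_{n,1}`" (indexing from `0` with `c_0 = 0 = [x] p_0`).
[cite: RotaKahanerOdlyzko1973, §4 Theorem 5 Corollary 1, p. 697] -/
theorem exists_isBasicSequence_coeff_one_eq {c : ℕ → K} (hc0 : c 0 = 0) (hc1 : c 1 ≠ 0) :
    ∃ (Q : K[X] →ₗ[K] K[X]) (p : ℕ → K[X]), IsDeltaOperator Q ∧ IsBasicSequence Q p ∧
      ∀ n, (p n).coeff 1 = c n :=
  ⟨_, _, isDeltaOperator_diffOp_indicator_mk_div_factorial hc0 hc1,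
    (isDeltaOperator_diffOp_indicator_mk_div_factorial hc0 hc1).isBasicSequence_basicSequence,
    coeff_one_basicSequence_indicator hc0 hc1 _⟩

/-- **Corollary 1** (existence and uniqueness together): for constants `c_n` with `c_0 = 0`, `c_1 ≠ 0`
there is exactly one basic sequence (of some delta operator) with `[x] p_n = c_n` for all `n`.
[cite: RotaKahanerOdlyzko1973, §4 Theorem 5 Corollary 1, p. 697] -/
theorem existsUnique_isBasicSequence_coeff_one_eq {c : ℕ → K} (hc0 : c 0 = 0) (hc1 : c 1 ≠ 0) :
    ∃! p : ℕ → K[X], (∃ Q : K[X] →ₗ[K] K[X], IsDeltaOperator Q ∧ IsBasicSequence Q p) ∧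
      ∀ n, (p n).coeff 1 = c n := by
  obtain ⟨Q, p, hQ, hp, hc⟩ := exists_isBasicSequence_coeff_one_eq hc0 hc1
  refine ⟨p, ⟨⟨Q, hQ, hp⟩, hc⟩, ?_⟩
  rintro p' ⟨⟨Q', hQ', hp'⟩, hc'⟩
  exact hp'.eq_of_coeff_one_eq hQ' hQ hp fun n => by rw [hc', hc]

end Literature.Algebra.Polynomial
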